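import Literature.NumberTheory.Automorphic.UnitaryThreeTorusBlockElements        -- ★ γ2b-A p841319/p841504 (+ γ2a, γ0, B-p04, (F1))
import Literature.NumberTheory.Automorphic.UnitaryThreeTorusNormOneIndex         -- ★ γ3b: `[G : S] = [Rˣ : U_j]` (+ bridge, ★ p840757)
import Literature.NumberTheory.Automorphic.UnitaryThreeDoubleCosetsHKDefs         -- ★ B-p17 DEFS: `flickerKH`
import HarnessLib

/-!
# Flicker's Proposition 6 (c) in the `U(Φ₃)` frame: the weight `[T_H^θ : T_H^θ ∩ r_i K_H r_i⁻¹] = [R_E^× : R_E(2i+ε)^×] = (q+1)q^{2i+ε−1}`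
(Flicker (1998), *Elementary proof of the fundamental lemma for a unitary group*, Prop. 6 (c) p. 83, Prop. 7 p. 84)

Topic `NumberTheory/Automorphic`; namespace `Literature.NumberTheory.Automorphic.UnitaryGroup`.  KERNEL mathematics only: theorems, no definition, no
named fact, no instance, no notation, no `sorry`.  Cell `pub/hodgecm-mathlib`, programme P3a, road «D-N7-inert», MAP v3 «N7-ns COUNT FROM FLICKER», brick
(F3c-γ) «LATTICE ↔ COSET TRANSPORT» FILE γ3a = the per-`i` WEIGHT of ★ B-p04 (g33) p841447 `natCard_fixedPoints_centralizer_eq_finsum` in the exact coset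
form asked 05:34:35Z (LEAD F0P3a-plan (g9) T8-60 (C); architect A-p06 (g26)).  HC_CM is proved only modulo the printed citations (2 remaining named inputs
hLiu418, h413) until rung 0 closes; this file discharges no named fact.

MATHEMATICS.  `T = Z_H(t)` (`t = !![A,0,B;0,b,0;C,0,A]`, `C ≠ 0`, `B = Cθ²`) consists of the blocks `!![p, 0, θ²q; 0, e, 0; q, 0, p]` (★ γ2a); the corner
`p·1 + q·N_θ` (`N_θ² = θ²`) has the simultaneous eigenvalues **`μ± = p ± θq`**, which are NORM-ONE (★ γ0: `σp = p∕Δ`, `σq = −q∕Δ`, `Δ = p² − θ²q² = μ₊μ₋`) and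
MULTIPLICATIVE in `τ`; so **`f : T →* Kˣ`, `τ ↦ μ₊∕μ₋`** is a homomorphism with norm-one values, reaching every `ι u∕σ(ι u)` (take `μ₊ = ι u∕σ(ι u)`, `μ₋ = 1`).
Conjugating by `r_i = diag(ϖ^{−i},1,ϖ^{i})` multiplies `q` by `ϖ^{−2i}` and `θ²q` by `ϖ^{2i}`, so `τ ∈ r_i K_H r_i⁻¹ ⟺ |q| ≤ |ϖ|^{2i} ⟺ |f τ − 1| ≤ |ϖ|^{2i+ε}`
(`f τ − 1 = 2θq∕μ₋`, `|2| = |μ₋| = 1`, `|θ| = |ϖ|^ε`).  Hence by ★ γ3b `index_eq_index_units_of_normOne` and ★ (F3a) `index_comap_eqLocus_eq`∕`_zero`: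
**`relIndex = [Rˣ : U_{2i+ε}] = if 2i+ε = 0 then 1 else (q+1)·q^{2i+ε−1}`**.

References: [Flicker1998UnitaryFL] Y. Z. Flicker, Canad. J. Math. 50 (1998), Prop. 6 (c) p. 83, Prop. 7 p. 84 · [Rogawski1990] J. D. Rogawski, Ann. of Math. Stud. 123, §4.9 p. 55. -/

set_option autoImplicit false

open Matrix
open scoped MatrixGroups WithZero

namespace Literature.NumberTheory.Automorphic.UnitaryGroup

open IsLocalRing
open Literature.NumberTheory.Automorphic.HermitianLattice (unitaryInt LocalConjDatum)

section Torus

variable {K : Type*} [Field K] (σ : K →+* K) {J : Matrix (Fin 3) (Fin 3) K} (hJ : J = (StdForm.antidiagonal 3).over K)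

/-- **Shape of `Z_H(t)`**: an element of `H` commuting with the regular torus block `t = !![A,0,B;0,b,0;C,0,A]` (`C ≠ 0`, `B = Cθ²`) is
`!![p, 0, θ²q; 0, e, 0; q, 0, p]` with `p, q` its `(0,0)`, `(2,0)` entries (★ `mem_centralizer_block_iff`). [cite: Flicker1998UnitaryFL, Prop. 6 p. 83] -/
theorem exists_coe_eq_torus_of_mem_centralizer (h2 : (2 : K) ≠ 0) {c t τ : ↥(unitaryGroupOfForm σ J)}
    (hc : ((c : GL (Fin 3) K) : Matrix (Fin 3) (Fin 3) K) = !![1, 0, 0; 0, -1, 0; 0, 0, 1]) {θ A B C b : K}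
    (hte : ((t : GL (Fin 3) K) : Matrix (Fin 3) (Fin 3) K) = !![A, 0, B; 0, b, 0; C, 0, A]) (hC : C ≠ 0) (hB : B = C * θ ^ 2)
    (hτH : τ ∈ Subgroup.centralizer ({c} : Set ↥(unitaryGroupOfForm σ J))) (hτt : τ ∈ Subgroup.centralizer ({t} : Set ↥(unitaryGroupOfForm σ J))) :
    ∃ e : K, ((τ : GL (Fin 3) K) : Matrix (Fin 3) (Fin 3) K) =
      !![((τ : GL (Fin 3) K) : Matrix (Fin 3) (Fin 3) K) 0 0, 0, θ ^ 2 * ((τ : GL (Fin 3) K) : Matrix (Fin 3) (Fin 3) K) 2 0; 0, e, 0;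
        ((τ : GL (Fin 3) K) : Matrix (Fin 3) (Fin 3) K) 2 0, 0, ((τ : GL (Fin 3) K) : Matrix (Fin 3) (Fin 3) K) 0 0] := by
  obtain ⟨α, β, γ, δ, e, hτ⟩ := exists_coe_eq_block_of_mem_centralizer σ h2 hc hτH
  obtain ⟨hαδ, hβγ⟩ := (mem_centralizer_block_iff σ hτ hte hC).1 hτt
  have hβ : β = θ ^ 2 * γ := mul_right_cancel₀ hC (by rw [hβγ, hB]; ring)
  refine ⟨e, ?_⟩
  rw [hτ]; simp [hαδ, hβ]

/-- **The eigenvalues `μ± = p ± θq` of a torus block are norm-one** (from the four unitarity relations of the corner `(p, θ²q; q, p)`):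
`(p ± θq)·σ(p ± θq) = 1`, in particular `p ± θq ≠ 0`. [cite: Flicker1998UnitaryFL, Prop. 6 p. 83] -/
theorem eigen_mul_map_eq_one {p q θ : K} (hσθ : σ θ = θ)
    (R1 : σ p * q + σ q * p = 0) (R2 : σ p * p + σ q * (θ ^ 2 * q) = 1) (R3 : σ (θ ^ 2 * q) * q + σ p * p = 1)
    (R4 : σ (θ ^ 2 * q) * p + σ p * (θ ^ 2 * q) = 0) :
    (p + θ * q) * σ (p + θ * q) = 1 ∧ (p - θ * q) * σ (p - θ * q) = 1 := by
  have ha := SplitDictionary.map_a_mul_det σ R1 R2   -- σp Δ = p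
  have hc := SplitDictionary.map_c_mul_det σ R1 R2   -- σq Δ = −q
  have hΔ := SplitDictionary.det_ne_zero σ R1 R2
  have hN := SplitDictionary.det_mul_map_det σ R1 R2 R3 R4
  have eσp : σ p = p / (p * p - θ ^ 2 * q * q) := by rw [eq_div_iff hΔ]; exact ha
  have eσq : σ q = -q / (p * p - θ ^ 2 * q * q) := by rw [eq_div_iff hΔ]; exact hc
  have hΔ' : p ^ 2 - θ ^ 2 * q ^ 2 ≠ 0 := fun h => hΔ (by linear_combination h)
  constructor
  · rw [map_add, map_mul, hσθ, eσp, eσq]; field_simp; ring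
  · rw [map_sub, map_mul, hσθ, eσp, eσq]; field_simp; ring

end Torus

/-! ## §2 The weight -/

section Weight

variable {K : Type*} [Field K] [Valued K ℤᵐ⁰] {ϖ : K} (σ : K →+* K) {J : Matrix (Fin 3) (Fin 3) K}
  (hJ : J = (StdForm.antidiagonal 3).over K) (hd : LocalConjDatum σ ϖ)

universe u

/-- **Integrality of the `r_i`-conjugate of a torus block**: for `M = !![p, 0, ϖ^i θ²q ϖ^i; 0, e, 0; ϖ^{−i} q ϖ^{−i}, 0, p]` with `|p| ≤ 1`, `|e| = 1`,
`|θ| ≤ 1`: all entries are integral iff `|q| ≤ |ϖ^i|²`. [cite: Flicker1998UnitaryFL, Prop. 6 (c) p. 83] -/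
theorem forall_v_radialConj_le_one_iff {p q e θ ϖ : K} {i : ℕ} (hϖ0 : ϖ ≠ 0) (hvϖ : Valued.v ϖ ≤ 1) (hvp : Valued.v p ≤ 1)
    (hve : Valued.v e = 1) (hvθ : Valued.v θ ≤ 1) :
    (∀ a b : Fin 3, Valued.v ((!![p, 0, ϖ ^ i * (θ ^ 2 * q) * ϖ ^ i; 0, e, 0; (ϖ ^ i)⁻¹ * q * (ϖ ^ i)⁻¹, 0, p] :
        Matrix (Fin 3) (Fin 3) K) a b) ≤ 1) ↔ Valued.v q ≤ Valued.v (ϖ ^ i) * Valued.v (ϖ ^ i) := by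
  have hϖi0 : ϖ ^ i ≠ 0 := pow_ne_zero _ hϖ0
  have hvi0 : Valued.v (ϖ ^ i * ϖ ^ i) ≠ 0 := (Valuation.ne_zero_iff _).2 (mul_ne_zero hϖi0 hϖi0)
  have hvi1 : Valued.v (ϖ ^ i) ≤ 1 := by rw [map_pow]; exact pow_le_one₀ zero_le hvϖ
  have e20 : (ϖ ^ i)⁻¹ * q * (ϖ ^ i)⁻¹ = q / (ϖ ^ i * ϖ ^ i) := by field_simp
  have key : Valued.v ((ϖ ^ i)⁻¹ * q * (ϖ ^ i)⁻¹) ≤ 1 ↔ Valued.v q ≤ Valued.v (ϖ ^ i) * Valued.v (ϖ ^ i) := by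
    rw [e20, map_div₀, div_le_one₀ (zero_lt_iff.2 hvi0), map_mul]
  constructor
  · intro h
    exact key.1 (h 2 0)
  · intro hq a b
    have hq1 : Valued.v q ≤ 1 := hq.trans (mul_le_one' hvi1 hvi1)
    have hvi1' : Valued.v ϖ ^ i ≤ 1 := pow_le_one₀ zero_le hvϖ
    have hθ2 : Valued.v θ ^ 2 ≤ 1 := pow_le_one₀ zero_le hvθ
    have h02 : Valued.v (ϖ ^ i * (θ ^ 2 * q) * ϖ ^ i) ≤ 1 := by
      rw [map_mul, map_mul, map_mul, map_pow, map_pow]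
      exact mul_le_one' (mul_le_one' hvi1' (mul_le_one' hθ2 hq1)) hvi1'
    have h20 : Valued.v ((ϖ ^ i)⁻¹ * q * (ϖ ^ i)⁻¹) ≤ 1 := key.2 hq
    fin_cases a <;> fin_cases b <;> first | exact hvp | exact hve.le | exact h02 | exact h20 | simp

set_option maxHeartbeats 1600000 in
-- one long explicit computation (the torus hom `τ ↦ μ₊∕μ₋`, its surjectivity and the integrality criterion)
include hJ hd in
/-- **FLICKER'S PROPOSITION 6 (c) — THE WEIGHT `[T_H^θ : T_H^θ ∩ r_i K_H r_i⁻¹] = [R_E^× : R_E(2i+ε)^×] = (q+1)·q^{2i+ε−1}`** (and `= 1` when `2i+ε = 0`),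
in the `U(Φ₃)` frame: `T_H^θ = Z_H(t)` for the regular torus block `t = !![A,0,B;0,b₀,0;C,0,A]` (`C ≠ 0`, `Bθ′ = Cθ`, `θ = ϖ^ε`), `r_i = diag(ϖ^{−i},1,ϖ^{i})`,
`K_H = flickerKH`; `q² = #𝓀_E` through the bridge `(R, ι)` (`R := 𝒪[K]` at the junction).  This is the per-`i` factor of ★ B-p04
`natCard_fixedPoints_centralizer_eq_finsum` (Cor. 9), in its requested spelling.  PROOF: the homomorphism `τ ↦ μ₊∕μ₋` (`μ± = p ± θq`, §1) to the norm-one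
group, `τ ∈ r_iK_Hr_i⁻¹ ⟺ |q| ≤ |ϖ|^{2i} ⟺ |μ₊∕μ₋ − 1| ≤ |ϖ|^{2i+ε}`, then ★ γ3b `index_eq_index_units_of_normOne` and ★ (F3a) `index_comap_eqLocus_eq`∕`_zero`.
[cite: Flicker1998UnitaryFL, Prop. 6 (c) p. 83, Prop. 7 p. 84] -/
theorem relIndex_flickerKH_conj_diagRadial_eq
    {R : Type u} [CommRing R] [IsDomain R] [IsDiscreteValuationRing R] [Finite (ResidueField R)] (ι : R →+* K) (hι : Function.Injective ι)
    (hιv : ∀ x : K, Valued.v x ≤ 1 ↔ x ∈ Set.range ι) (σR : R →+* R) (hσR : ∀ r, σR (σR r) = r) (hσι : ∀ r, ι (σR r) = σ (ι r))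
    {dR : R} (hdRσ : σR dR = -dR) (hdRu : IsUnit dR) (h2R : IsUnit (2 : R)) {ϖR : R} (hϖR : Irreducible ϖR) (hιϖ : ι ϖR = ϖ)
    {q₀ : ℕ} (hq : Nat.card (ResidueField R) = q₀ ^ 2)
    {c : ↥(unitaryGroupOfForm σ J)} (hc : ((c : GL (Fin 3) K) : Matrix (Fin 3) (Fin 3) K) = !![1, 0, 0; 0, -1, 0; 0, 0, 1])
    {θ θ' : K} {ε : ℕ} (hθε : θ = ϖ ^ ε) (hθ : θ * θ' = 1)
    {t : ↥(unitaryGroupOfForm σ J)} (htH : t ∈ Subgroup.centralizer ({c} : Set ↥(unitaryGroupOfForm σ J))) {A B C b₀ : K}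
    (hte : ((t : GL (Fin 3) K) : Matrix (Fin 3) (Fin 3) K) = !![A, 0, B; 0, b₀, 0; C, 0, A]) (hC : C ≠ 0) (hBC : B * θ' = C * θ)
    (r : ℕ → ↥(Subgroup.centralizer ({c} : Set ↥(unitaryGroupOfForm σ J))))
    (hr : ∀ i, (((r i : ↥(unitaryGroupOfForm σ J)) : GL (Fin 3) K) : Matrix (Fin 3) (Fin 3) K) = !![(ϖ ^ i)⁻¹, 0, 0; 0, 1, 0; 0, 0, ϖ ^ i])
    (i : ℕ) :
    ((((flickerKH σ J c).subgroupOf (Subgroup.centralizer ({c} : Set ↥(unitaryGroupOfForm σ J)))).map (MulAut.conj (r i)).toMonoidHom).relIndex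
        (Subgroup.centralizer ({⟨t, htH⟩} : Set ↥(Subgroup.centralizer ({c} : Set ↥(unitaryGroupOfForm σ J)))))) =
      if 2 * i + ε = 0 then 1 else (q₀ + 1) * q₀ ^ (2 * i + ε - 1) := by
  classical
  -- scalar facts
  have h2 : (2 : K) ≠ 0 := fun h0 => by have := hd.v2; rw [h0, map_zero] at this; exact zero_ne_one this
  have hϖ0 : ϖ ≠ 0 := fun h0 => by have := hd.vϖ; rw [h0, map_zero] at this; exact WithZero.zero_ne_coe this
  have hθ0 : θ ≠ 0 := by rw [hθε]; exact pow_ne_zero _ hϖ0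
  have hσϖ : σ ϖ = ϖ := hd.σϖ
  have hσθ : σ θ = θ := by rw [hθε, map_pow, hσϖ]
  have hθ'e : θ' = θ⁻¹ := (inv_eq_of_mul_eq_one_right hθ).symm
  have hBq : B = C * θ ^ 2 := by rw [hθ'e] at hBC; field_simp at hBC; linear_combination hBC
  set d : K := ι dR with hd_def
  have hdK : σ d = -d := by rw [hd_def, ← hσι, hdRσ, map_neg]
  have hvd : Valued.v d = 1 := TorusBridge.v_eq_one_of_isUnit ι hιv hdRu
  have ha : IsUnit (σR dR - dR) := by
    have : σR dR - dR = -(2 * dR) := by rw [hdRσ]; ring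
    rw [this]; exact (h2R.mul hdRu).neg
  have hvθ : Valued.v θ = Valued.v (ϖ ^ ε) := by rw [hθε]
  -- the matrix of `τ : ↥(Subgroup.centralizer ({⟨t, htH⟩} : Set ↥(Subgroup.centralizer ({c} : Set ↥(unitaryGroupOfForm σ J)))))` and its torus shape
  have hshape : ∀ τ : ↥(Subgroup.centralizer ({⟨t, htH⟩} : Set ↥(Subgroup.centralizer ({c} : Set ↥(unitaryGroupOfForm σ J))))), ∃ e : K, ((((τ : ↥(Subgroup.centralizer ({c} : Set ↥(unitaryGroupOfForm σ J)))) : ↥(unitaryGroupOfForm σ J)) : GL (Fin 3) K) : Matrix (Fin 3) (Fin 3) K) =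
      !![((((τ : ↥(Subgroup.centralizer ({c} : Set ↥(unitaryGroupOfForm σ J)))) : ↥(unitaryGroupOfForm σ J)) : GL (Fin 3) K) : Matrix (Fin 3) (Fin 3) K) 0 0, 0,
          θ ^ 2 * ((((τ : ↥(Subgroup.centralizer ({c} : Set ↥(unitaryGroupOfForm σ J)))) : ↥(unitaryGroupOfForm σ J)) : GL (Fin 3) K) : Matrix (Fin 3) (Fin 3) K) 2 0;
        0, e, 0;
        ((((τ : ↥(Subgroup.centralizer ({c} : Set ↥(unitaryGroupOfForm σ J)))) : ↥(unitaryGroupOfForm σ J)) : GL (Fin 3) K) : Matrix (Fin 3) (Fin 3) K) 2 0, 0,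
          ((((τ : ↥(Subgroup.centralizer ({c} : Set ↥(unitaryGroupOfForm σ J)))) : ↥(unitaryGroupOfForm σ J)) : GL (Fin 3) K) : Matrix (Fin 3) (Fin 3) K) 0 0] := by
    intro τ
    have hτt : ((τ : ↥(Subgroup.centralizer ({c} : Set ↥(unitaryGroupOfForm σ J)))) : ↥(unitaryGroupOfForm σ J)) ∈ Subgroup.centralizer ({t} : Set ↥(unitaryGroupOfForm σ J)) := by
      rw [Subgroup.mem_centralizer_singleton_iff]
      exact congrArg Subtype.val (Subgroup.mem_centralizer_singleton_iff.1 τ.2)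
    exact exists_coe_eq_torus_of_mem_centralizer σ h2 hc hte hC hBq (τ : ↥(Subgroup.centralizer ({c} : Set ↥(unitaryGroupOfForm σ J)))).2 hτt
  -- the unitarity relations of the corner `(p, θ²q; q, p)` and the norm-one eigenvalues
  have hrel : ∀ τ : ↥(Subgroup.centralizer ({⟨t, htH⟩} : Set ↥(Subgroup.centralizer ({c} : Set ↥(unitaryGroupOfForm σ J))))),
      let p := ((((τ : ↥(Subgroup.centralizer ({c} : Set ↥(unitaryGroupOfForm σ J)))) : ↥(unitaryGroupOfForm σ J)) : GL (Fin 3) K) : Matrix (Fin 3) (Fin 3) K) 0 0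
      let q := ((((τ : ↥(Subgroup.centralizer ({c} : Set ↥(unitaryGroupOfForm σ J)))) : ↥(unitaryGroupOfForm σ J)) : GL (Fin 3) K) : Matrix (Fin 3) (Fin 3) K) 2 0
      ((p + θ * q) * σ (p + θ * q) = 1 ∧ (p - θ * q) * σ (p - θ * q) = 1) ∧ Valued.v p ≤ 1 ∧
        ∃ e : K, Valued.v e = 1 ∧ ((((τ : ↥(Subgroup.centralizer ({c} : Set ↥(unitaryGroupOfForm σ J)))) : ↥(unitaryGroupOfForm σ J)) : GL (Fin 3) K) : Matrix (Fin 3) (Fin 3) K) =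
          !![p, 0, θ ^ 2 * q; 0, e, 0; q, 0, p] := by
    intro τ p q
    obtain ⟨e, he⟩ := hshape τ
    have h3 : (((τ : ↥(Subgroup.centralizer ({c} : Set ↥(unitaryGroupOfForm σ J)))) : ↥(unitaryGroupOfForm σ J)) : GL (Fin 3) K) ∈ unitaryGroupOfForm σ ((StdForm.antidiagonal 3).over K) := by
      rw [← hJ]; exact ((τ : ↥(Subgroup.centralizer ({c} : Set ↥(unitaryGroupOfForm σ J)))) : ↥(unitaryGroupOfForm σ J)).2
    obtain ⟨⟨R1, R2, R3, R4⟩, hee⟩ := SplitDictionary.rel_of_coe_eq_block σ h3 he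
    have hμ := eigen_mul_map_eq_one σ hσθ R1 R2 R3 R4
    have hv1 : ∀ {x : K}, x * σ x = 1 → Valued.v x = 1 := by
      intro x hx
      have h1 := congrArg Valued.v hx
      rw [map_mul, hd.vσ, map_one] at h1
      exact Literature.NumberTheory.QuadraticForms.OMeara65.WithZeroMulInt.eq_one_of_mul_self h1
    refine ⟨hμ, ?_, e, ?_, he⟩
    · have ep : p = ((p + θ * q) + (p - θ * q)) / 2 := by field_simp; ring
      rw [ep, map_div₀, hd.v2, div_one]
      exact Valuation.map_add_le _ (hv1 hμ.1).le (hv1 hμ.2).le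
    · have h1 := congrArg Valued.v hee
      rw [map_mul, hd.vσ, map_one] at h1
      exact Literature.NumberTheory.QuadraticForms.OMeara65.WithZeroMulInt.eq_one_of_mul_self h1
  -- the homomorphism `f : T → Kˣ`, `τ ↦ μ₊ ∕ μ₋`
  have hne : ∀ τ : ↥(Subgroup.centralizer ({⟨t, htH⟩} : Set ↥(Subgroup.centralizer ({c} : Set ↥(unitaryGroupOfForm σ J))))),
      ((((τ : ↥(Subgroup.centralizer ({c} : Set ↥(unitaryGroupOfForm σ J)))) : ↥(unitaryGroupOfForm σ J)) : GL (Fin 3) K) : Matrix (Fin 3) (Fin 3) K) 0 0 +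
          θ * ((((τ : ↥(Subgroup.centralizer ({c} : Set ↥(unitaryGroupOfForm σ J)))) : ↥(unitaryGroupOfForm σ J)) : GL (Fin 3) K) : Matrix (Fin 3) (Fin 3) K) 2 0 ≠ 0 ∧
      ((((τ : ↥(Subgroup.centralizer ({c} : Set ↥(unitaryGroupOfForm σ J)))) : ↥(unitaryGroupOfForm σ J)) : GL (Fin 3) K) : Matrix (Fin 3) (Fin 3) K) 0 0 -
          θ * ((((τ : ↥(Subgroup.centralizer ({c} : Set ↥(unitaryGroupOfForm σ J)))) : ↥(unitaryGroupOfForm σ J)) : GL (Fin 3) K) : Matrix (Fin 3) (Fin 3) K) 2 0 ≠ 0 := by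
    intro τ
    obtain ⟨⟨h1, h2'⟩, -, -⟩ := hrel τ
    exact ⟨fun h0 => by rw [h0, zero_mul] at h1; exact zero_ne_one h1, fun h0 => by rw [h0, zero_mul] at h2'; exact zero_ne_one h2'⟩
  let F : ↥(Subgroup.centralizer ({⟨t, htH⟩} : Set ↥(Subgroup.centralizer ({c} : Set ↥(unitaryGroupOfForm σ J))))) → Kˣ := fun τ => Units.mk0
    ((((((τ : ↥(Subgroup.centralizer ({c} : Set ↥(unitaryGroupOfForm σ J)))) : ↥(unitaryGroupOfForm σ J)) : GL (Fin 3) K) : Matrix (Fin 3) (Fin 3) K) 0 0 +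
        θ * ((((τ : ↥(Subgroup.centralizer ({c} : Set ↥(unitaryGroupOfForm σ J)))) : ↥(unitaryGroupOfForm σ J)) : GL (Fin 3) K) : Matrix (Fin 3) (Fin 3) K) 2 0) /
      (((((τ : ↥(Subgroup.centralizer ({c} : Set ↥(unitaryGroupOfForm σ J)))) : ↥(unitaryGroupOfForm σ J)) : GL (Fin 3) K) : Matrix (Fin 3) (Fin 3) K) 0 0 -
        θ * ((((τ : ↥(Subgroup.centralizer ({c} : Set ↥(unitaryGroupOfForm σ J)))) : ↥(unitaryGroupOfForm σ J)) : GL (Fin 3) K) : Matrix (Fin 3) (Fin 3) K) 2 0))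
    (div_ne_zero (hne τ).1 (hne τ).2)
  have hFv : ∀ τ : ↥(Subgroup.centralizer ({⟨t, htH⟩} : Set ↥(Subgroup.centralizer ({c} : Set ↥(unitaryGroupOfForm σ J))))), ((F τ : Kˣ) : K) =
      (((((τ : ↥(Subgroup.centralizer ({c} : Set ↥(unitaryGroupOfForm σ J)))) : ↥(unitaryGroupOfForm σ J)) : GL (Fin 3) K) : Matrix (Fin 3) (Fin 3) K) 0 0 +
          θ * ((((τ : ↥(Subgroup.centralizer ({c} : Set ↥(unitaryGroupOfForm σ J)))) : ↥(unitaryGroupOfForm σ J)) : GL (Fin 3) K) : Matrix (Fin 3) (Fin 3) K) 2 0) /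
        (((((τ : ↥(Subgroup.centralizer ({c} : Set ↥(unitaryGroupOfForm σ J)))) : ↥(unitaryGroupOfForm σ J)) : GL (Fin 3) K) : Matrix (Fin 3) (Fin 3) K) 0 0 -
          θ * ((((τ : ↥(Subgroup.centralizer ({c} : Set ↥(unitaryGroupOfForm σ J)))) : ↥(unitaryGroupOfForm σ J)) : GL (Fin 3) K) : Matrix (Fin 3) (Fin 3) K) 2 0) := fun τ => rfl
  have hmul : ∀ τ₁ τ₂ : ↥(Subgroup.centralizer ({⟨t, htH⟩} : Set ↥(Subgroup.centralizer ({c} : Set ↥(unitaryGroupOfForm σ J))))), F (τ₁ * τ₂) = F τ₁ * F τ₂ := by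
    intro τ₁ τ₂
    apply Units.ext
    rw [Units.val_mul, hFv, hFv, hFv]
    obtain ⟨-, -, e₁, -, h₁⟩ := hrel τ₁
    obtain ⟨-, -, e₂, -, h₂⟩ := hrel τ₂
    have hn₁ := hne τ₁
    have hn₂ := hne τ₂
    have hm : (((((τ₁ * τ₂ : ↥(Subgroup.centralizer ({⟨t, htH⟩} : Set ↥(Subgroup.centralizer ({c} : Set ↥(unitaryGroupOfForm σ J)))))) : ↥(Subgroup.centralizer ({c} : Set ↥(unitaryGroupOfForm σ J)))) : ↥(unitaryGroupOfForm σ J)) : GL (Fin 3) K) : Matrix (Fin 3) (Fin 3) K) =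
        ((((τ₁ : ↥(Subgroup.centralizer ({c} : Set ↥(unitaryGroupOfForm σ J)))) : ↥(unitaryGroupOfForm σ J)) : GL (Fin 3) K) : Matrix (Fin 3) (Fin 3) K) *
          ((((τ₂ : ↥(Subgroup.centralizer ({c} : Set ↥(unitaryGroupOfForm σ J)))) : ↥(unitaryGroupOfForm σ J)) : GL (Fin 3) K) : Matrix (Fin 3) (Fin 3) K) := by
      simp only [Subgroup.coe_mul, Units.val_mul]
    have e00 : (((((τ₁ * τ₂ : ↥(Subgroup.centralizer ({⟨t, htH⟩} : Set ↥(Subgroup.centralizer ({c} : Set ↥(unitaryGroupOfForm σ J)))))) : ↥(Subgroup.centralizer ({c} : Set ↥(unitaryGroupOfForm σ J)))) : ↥(unitaryGroupOfForm σ J)) : GL (Fin 3) K) : Matrix (Fin 3) (Fin 3) K) 0 0 =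
        ((((τ₁ : ↥(Subgroup.centralizer ({c} : Set ↥(unitaryGroupOfForm σ J)))) : ↥(unitaryGroupOfForm σ J)) : GL (Fin 3) K) : Matrix (Fin 3) (Fin 3) K) 0 0 *
            ((((τ₂ : ↥(Subgroup.centralizer ({c} : Set ↥(unitaryGroupOfForm σ J)))) : ↥(unitaryGroupOfForm σ J)) : GL (Fin 3) K) : Matrix (Fin 3) (Fin 3) K) 0 0 +
          θ ^ 2 * ((((τ₁ : ↥(Subgroup.centralizer ({c} : Set ↥(unitaryGroupOfForm σ J)))) : ↥(unitaryGroupOfForm σ J)) : GL (Fin 3) K) : Matrix (Fin 3) (Fin 3) K) 2 0 *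
            ((((τ₂ : ↥(Subgroup.centralizer ({c} : Set ↥(unitaryGroupOfForm σ J)))) : ↥(unitaryGroupOfForm σ J)) : GL (Fin 3) K) : Matrix (Fin 3) (Fin 3) K) 2 0 := by
      conv_lhs => rw [hm, h₁, h₂, block_mul_block]
      simp
    have e20 : (((((τ₁ * τ₂ : ↥(Subgroup.centralizer ({⟨t, htH⟩} : Set ↥(Subgroup.centralizer ({c} : Set ↥(unitaryGroupOfForm σ J)))))) : ↥(Subgroup.centralizer ({c} : Set ↥(unitaryGroupOfForm σ J)))) : ↥(unitaryGroupOfForm σ J)) : GL (Fin 3) K) : Matrix (Fin 3) (Fin 3) K) 2 0 =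
        ((((τ₁ : ↥(Subgroup.centralizer ({c} : Set ↥(unitaryGroupOfForm σ J)))) : ↥(unitaryGroupOfForm σ J)) : GL (Fin 3) K) : Matrix (Fin 3) (Fin 3) K) 2 0 *
            ((((τ₂ : ↥(Subgroup.centralizer ({c} : Set ↥(unitaryGroupOfForm σ J)))) : ↥(unitaryGroupOfForm σ J)) : GL (Fin 3) K) : Matrix (Fin 3) (Fin 3) K) 0 0 +
          ((((τ₁ : ↥(Subgroup.centralizer ({c} : Set ↥(unitaryGroupOfForm σ J)))) : ↥(unitaryGroupOfForm σ J)) : GL (Fin 3) K) : Matrix (Fin 3) (Fin 3) K) 0 0 *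
            ((((τ₂ : ↥(Subgroup.centralizer ({c} : Set ↥(unitaryGroupOfForm σ J)))) : ↥(unitaryGroupOfForm σ J)) : GL (Fin 3) K) : Matrix (Fin 3) (Fin 3) K) 2 0 := by
      conv_lhs => rw [hm, h₁, h₂, block_mul_block]
      simp
    rw [e00, e20, div_mul_div_comm]
    set p₁ := ((((τ₁ : ↥(Subgroup.centralizer ({c} : Set ↥(unitaryGroupOfForm σ J)))) : ↥(unitaryGroupOfForm σ J)) : GL (Fin 3) K) : Matrix (Fin 3) (Fin 3) K) 0 0
    set q₁ := ((((τ₁ : ↥(Subgroup.centralizer ({c} : Set ↥(unitaryGroupOfForm σ J)))) : ↥(unitaryGroupOfForm σ J)) : GL (Fin 3) K) : Matrix (Fin 3) (Fin 3) K) 2 0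
    set p₂ := ((((τ₂ : ↥(Subgroup.centralizer ({c} : Set ↥(unitaryGroupOfForm σ J)))) : ↥(unitaryGroupOfForm σ J)) : GL (Fin 3) K) : Matrix (Fin 3) (Fin 3) K) 0 0
    set q₂ := ((((τ₂ : ↥(Subgroup.centralizer ({c} : Set ↥(unitaryGroupOfForm σ J)))) : ↥(unitaryGroupOfForm σ J)) : GL (Fin 3) K) : Matrix (Fin 3) (Fin 3) K) 2 0
    have e1 : p₁ * p₂ + θ ^ 2 * q₁ * q₂ + θ * (q₁ * p₂ + p₁ * q₂) = (p₁ + θ * q₁) * (p₂ + θ * q₂) := by ring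
    have e2 : p₁ * p₂ + θ ^ 2 * q₁ * q₂ - θ * (q₁ * p₂ + p₁ * q₂) = (p₁ - θ * q₁) * (p₂ - θ * q₂) := by ring
    rw [e1, e2]
  let f : ↥(Subgroup.centralizer ({⟨t, htH⟩} : Set ↥(Subgroup.centralizer ({c} : Set ↥(unitaryGroupOfForm σ J))))) →* Kˣ := MonoidHom.mk' F hmul
  have hfv : ∀ τ : ↥(Subgroup.centralizer ({⟨t, htH⟩} : Set ↥(Subgroup.centralizer ({c} : Set ↥(unitaryGroupOfForm σ J))))), ((f τ : Kˣ) : K) =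
      (((((τ : ↥(Subgroup.centralizer ({c} : Set ↥(unitaryGroupOfForm σ J)))) : ↥(unitaryGroupOfForm σ J)) : GL (Fin 3) K) : Matrix (Fin 3) (Fin 3) K) 0 0 +
          θ * ((((τ : ↥(Subgroup.centralizer ({c} : Set ↥(unitaryGroupOfForm σ J)))) : ↥(unitaryGroupOfForm σ J)) : GL (Fin 3) K) : Matrix (Fin 3) (Fin 3) K) 2 0) /
        (((((τ : ↥(Subgroup.centralizer ({c} : Set ↥(unitaryGroupOfForm σ J)))) : ↥(unitaryGroupOfForm σ J)) : GL (Fin 3) K) : Matrix (Fin 3) (Fin 3) K) 0 0 -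
          θ * ((((τ : ↥(Subgroup.centralizer ({c} : Set ↥(unitaryGroupOfForm σ J)))) : ↥(unitaryGroupOfForm σ J)) : GL (Fin 3) K) : Matrix (Fin 3) (Fin 3) K) 2 0) := fun τ => rfl
  -- norm-one values
  have hf : ∀ τ : ↥(Subgroup.centralizer ({⟨t, htH⟩} : Set ↥(Subgroup.centralizer ({c} : Set ↥(unitaryGroupOfForm σ J))))), ((f τ : Kˣ) : K) * σ ((f τ : Kˣ) : K) = 1 := by
    intro τ
    obtain ⟨⟨h1, h2'⟩, -, -⟩ := hrel τ
    rw [hfv, map_div₀, div_mul_div_comm, h1, h2', div_one]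
  -- surjectivity onto `E¹`: `μ₊ = ι u ∕ σ(ι u)`, `μ₋ = 1`
  have hfs : ∀ u : Rˣ, ∃ τ : ↥(Subgroup.centralizer ({⟨t, htH⟩} : Set ↥(Subgroup.centralizer ({c} : Set ↥(unitaryGroupOfForm σ J))))), ((f τ : Kˣ) : K) = ι u / σ (ι u) := by
    intro u
    set μ : K := ι u / σ (ι u) with hμdef
    have hμ1 : μ * σ μ = 1 := TorusBridge.normOneMap_mul_map σ ι hι hd.σσ u
    have hμ0 : μ ≠ 0 := fun h0 => by rw [h0, zero_mul] at hμ1; exact zero_ne_one hμ1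
    have hσμ : σ μ = μ⁻¹ := (inv_eq_of_mul_eq_one_right hμ1).symm
    set pp : K := (μ + 1) / 2 with hpp
    set qq : K := (μ - 1) / (2 * θ) with hqq
    have hσpp : σ pp = (1 + μ) / (2 * μ) := by rw [hpp, map_div₀, map_add, map_one, map_ofNat, hσμ]; field_simp
    have hσqq : σ qq = (1 - μ) / (2 * θ * μ) := by rw [hqq, map_div₀, map_sub, map_one, map_mul, map_ofNat, hσθ, hσμ]; field_simp
    obtain ⟨τ₀, hτ₀⟩ := exists_coe_eq_block_of_rel σ hJ (α := pp) (β := θ ^ 2 * qq) (γ := qq) (δ := pp) (e := 1)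
      (by rw [hσpp, hσqq, hpp, hqq]; field_simp; ring)
      (by rw [hσpp, hσqq, hpp, hqq]; field_simp; ring)
      (by rw [map_mul, map_pow, hσθ, hσpp, hσqq, hpp, hqq]; field_simp; ring)
      (by rw [map_mul, map_pow, hσθ, hσpp, hσqq, hpp, hqq]; field_simp; ring)
      (by rw [map_one, mul_one])
    have hτ₀H : τ₀ ∈ (Subgroup.centralizer ({c} : Set ↥(unitaryGroupOfForm σ J))) := mem_centralizer_of_coe_eq_block σ hc hτ₀
    have hτ₀t : τ₀ ∈ Subgroup.centralizer ({t} : Set ↥(unitaryGroupOfForm σ J)) :=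
      (mem_centralizer_block_iff σ hτ₀ hte hC).2 ⟨rfl, by rw [hBq]; ring⟩
    have hτ₀T : (⟨τ₀, hτ₀H⟩ : ↥(Subgroup.centralizer ({c} : Set ↥(unitaryGroupOfForm σ J)))) ∈ (Subgroup.centralizer ({⟨t, htH⟩} : Set ↥(Subgroup.centralizer ({c} : Set ↥(unitaryGroupOfForm σ J))))) := by
      rw [Subgroup.mem_centralizer_singleton_iff]
      exact Subtype.ext (Subgroup.mem_centralizer_singleton_iff.1 hτ₀t)
    refine ⟨⟨⟨τ₀, hτ₀H⟩, hτ₀T⟩, ?_⟩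
    have e00 : ((τ₀ : GL (Fin 3) K) : Matrix (Fin 3) (Fin 3) K) 0 0 = pp := by rw [hτ₀]; simp
    have e20 : ((τ₀ : GL (Fin 3) K) : Matrix (Fin 3) (Fin 3) K) 2 0 = qq := by rw [hτ₀]; simp
    have hnum : pp + θ * qq = μ := by rw [hpp, hqq]; field_simp; ring
    have hden : pp - θ * qq = 1 := by rw [hpp, hqq]; field_simp; ring
    rw [hfv]
    change (((τ₀ : GL (Fin 3) K) : Matrix (Fin 3) (Fin 3) K) 0 0 + θ * ((τ₀ : GL (Fin 3) K) : Matrix (Fin 3) (Fin 3) K) 2 0) /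
      (((τ₀ : GL (Fin 3) K) : Matrix (Fin 3) (Fin 3) K) 0 0 - θ * ((τ₀ : GL (Fin 3) K) : Matrix (Fin 3) (Fin 3) K) 2 0) = μ
    rw [e00, e20, hnum, hden, div_one]
  -- the subgroup `S = T ∩ r_i K_H r_i⁻¹` and its integrality criterion
  set S : Subgroup ↥(Subgroup.centralizer ({⟨t, htH⟩} : Set ↥(Subgroup.centralizer ({c} : Set ↥(unitaryGroupOfForm σ J))))) := ((((flickerKH σ J c).subgroupOf (Subgroup.centralizer ({c} : Set ↥(unitaryGroupOfForm σ J))))).map (MulAut.conj (r i)).toMonoidHom).subgroupOf (Subgroup.centralizer ({⟨t, htH⟩} : Set ↥(Subgroup.centralizer ({c} : Set ↥(unitaryGroupOfForm σ J))))) with hSdef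
  have hϖi0 : ϖ ^ i ≠ 0 := pow_ne_zero _ hϖ0
  have hrinv : (((((r i)⁻¹ : ↥(Subgroup.centralizer ({c} : Set ↥(unitaryGroupOfForm σ J)))) : ↥(unitaryGroupOfForm σ J)) : GL (Fin 3) K) : Matrix (Fin 3) (Fin 3) K) =
      !![ϖ ^ i, 0, 0; 0, 1, 0; 0, 0, (ϖ ^ i)⁻¹] := by
    rw [Subgroup.coe_inv, Subgroup.coe_inv, Matrix.coe_units_inv, hr i]
    refine Matrix.inv_eq_left_inv ?_
    rw [block_mul_block]
    ext a b
    fin_cases a <;> fin_cases b <;> simp [hϖi0]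
  have hS : ∀ τ : ↥(Subgroup.centralizer ({⟨t, htH⟩} : Set ↥(Subgroup.centralizer ({c} : Set ↥(unitaryGroupOfForm σ J))))), τ ∈ S ↔ Valued.v (((f τ : Kˣ) : K) - 1) ≤ Valued.v (ι ϖR ^ (2 * i + ε)) := by
    intro τ
    obtain ⟨⟨h1, h2'⟩, hvp, e, hve, hM⟩ := hrel τ
    have hn := hne τ
    have hv1 : ∀ {x : K}, x * σ x = 1 → Valued.v x = 1 := by
      intro x hx
      have hh := congrArg Valued.v hx
      rw [map_mul, hd.vσ, map_one] at hh
      exact Literature.NumberTheory.QuadraticForms.OMeara65.WithZeroMulInt.eq_one_of_mul_self hh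
    have hvmm := hv1 h2'
    -- `|f τ − 1| = |θ|·|q|`
    have hfsub : Valued.v (((f τ : Kˣ) : K) - 1) =
        Valued.v θ * Valued.v (((((τ : ↥(Subgroup.centralizer ({c} : Set ↥(unitaryGroupOfForm σ J)))) : ↥(unitaryGroupOfForm σ J)) : GL (Fin 3) K) : Matrix (Fin 3) (Fin 3) K) 2 0) := by
      rw [hfv]
      have hd2 := hn.2
      have : (((((τ : ↥(Subgroup.centralizer ({c} : Set ↥(unitaryGroupOfForm σ J)))) : ↥(unitaryGroupOfForm σ J)) : GL (Fin 3) K) : Matrix (Fin 3) (Fin 3) K) 0 0 +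
            θ * ((((τ : ↥(Subgroup.centralizer ({c} : Set ↥(unitaryGroupOfForm σ J)))) : ↥(unitaryGroupOfForm σ J)) : GL (Fin 3) K) : Matrix (Fin 3) (Fin 3) K) 2 0) /
          (((((τ : ↥(Subgroup.centralizer ({c} : Set ↥(unitaryGroupOfForm σ J)))) : ↥(unitaryGroupOfForm σ J)) : GL (Fin 3) K) : Matrix (Fin 3) (Fin 3) K) 0 0 -
            θ * ((((τ : ↥(Subgroup.centralizer ({c} : Set ↥(unitaryGroupOfForm σ J)))) : ↥(unitaryGroupOfForm σ J)) : GL (Fin 3) K) : Matrix (Fin 3) (Fin 3) K) 2 0) - 1 =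
          2 * θ * ((((τ : ↥(Subgroup.centralizer ({c} : Set ↥(unitaryGroupOfForm σ J)))) : ↥(unitaryGroupOfForm σ J)) : GL (Fin 3) K) : Matrix (Fin 3) (Fin 3) K) 2 0 /
          (((((τ : ↥(Subgroup.centralizer ({c} : Set ↥(unitaryGroupOfForm σ J)))) : ↥(unitaryGroupOfForm σ J)) : GL (Fin 3) K) : Matrix (Fin 3) (Fin 3) K) 0 0 -
            θ * ((((τ : ↥(Subgroup.centralizer ({c} : Set ↥(unitaryGroupOfForm σ J)))) : ↥(unitaryGroupOfForm σ J)) : GL (Fin 3) K) : Matrix (Fin 3) (Fin 3) K) 2 0) := by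
        field_simp; ring
      rw [this, map_div₀, hvmm, div_one, map_mul, map_mul, hd.v2, one_mul]
    -- the conjugate `(r i)⁻¹ τ (r i)` and its matrix
    have hconj : (((((MulAut.conj (r i)).symm (τ : ↥(Subgroup.centralizer ({c} : Set ↥(unitaryGroupOfForm σ J)))) : ↥(Subgroup.centralizer ({c} : Set ↥(unitaryGroupOfForm σ J)))) : ↥(unitaryGroupOfForm σ J)) : GL (Fin 3) K) : Matrix (Fin 3) (Fin 3) K) =
        !![((((τ : ↥(Subgroup.centralizer ({c} : Set ↥(unitaryGroupOfForm σ J)))) : ↥(unitaryGroupOfForm σ J)) : GL (Fin 3) K) : Matrix (Fin 3) (Fin 3) K) 0 0, 0,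
            ϖ ^ i * (θ ^ 2 * ((((τ : ↥(Subgroup.centralizer ({c} : Set ↥(unitaryGroupOfForm σ J)))) : ↥(unitaryGroupOfForm σ J)) : GL (Fin 3) K) : Matrix (Fin 3) (Fin 3) K) 2 0) * ϖ ^ i;
          0, e, 0;
          (ϖ ^ i)⁻¹ * ((((τ : ↥(Subgroup.centralizer ({c} : Set ↥(unitaryGroupOfForm σ J)))) : ↥(unitaryGroupOfForm σ J)) : GL (Fin 3) K) : Matrix (Fin 3) (Fin 3) K) 2 0 * (ϖ ^ i)⁻¹, 0,
            ((((τ : ↥(Subgroup.centralizer ({c} : Set ↥(unitaryGroupOfForm σ J)))) : ↥(unitaryGroupOfForm σ J)) : GL (Fin 3) K) : Matrix (Fin 3) (Fin 3) K) 0 0] := by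
      rw [MulAut.conj_symm_apply, Subgroup.coe_mul, Subgroup.coe_mul, Subgroup.coe_mul, Subgroup.coe_mul, Units.val_mul, Units.val_mul,
        hrinv, hr i]
      conv_lhs => rw [hM]
      rw [block_mul_block, block_mul_block]
      ext a b
      fin_cases a <;> fin_cases b <;> simp <;> field_simp
    have hvθ1 : Valued.v θ ≤ 1 := by
      rw [hθε, map_pow, hd.vϖ, ← WithZero.exp_nsmul, ← WithZero.exp_zero, WithZero.exp_le_exp]; simp
    have hvϖ1 : Valued.v ϖ ≤ 1 := by rw [hd.vϖ, ← WithZero.exp_zero, WithZero.exp_le_exp]; simp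
    have hvθ0 : Valued.v θ ≠ 0 := (Valuation.ne_zero_iff _).2 hθ0
    have hpow : Valued.v (ϖ ^ (2 * i + ε)) = Valued.v θ * (Valued.v (ϖ ^ i) * Valued.v (ϖ ^ i)) := by
      rw [hθε, ← map_mul, ← map_mul]; congr 1; ring
    rw [hSdef, Subgroup.mem_subgroupOf, Subgroup.mem_map_equiv, Subgroup.mem_subgroupOf, mem_flickerKH_iff,
      mem_unitaryInt_iff_forall_v_apply_le_one σ hJ hd.vσ, hconj, forall_v_radialConj_le_one_iff hϖ0 hvϖ1 hvp hve hvθ1, hfsub, hιϖ, hpow]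
    constructor
    · rintro ⟨-, hq⟩
      exact mul_le_mul_right hq _
    · intro hle
      refine ⟨((MulAut.conj (r i)).symm (τ : ↥(Subgroup.centralizer ({c} : Set ↥(unitaryGroupOfForm σ J))))).2, ?_⟩
      calc Valued.v (((((τ : ↥(Subgroup.centralizer ({c} : Set ↥(unitaryGroupOfForm σ J)))) : ↥(unitaryGroupOfForm σ J)) : GL (Fin 3) K) : Matrix (Fin 3) (Fin 3) K) 2 0)
          = (Valued.v θ)⁻¹ * (Valued.v θ * Valued.v (((((τ : ↥(Subgroup.centralizer ({c} : Set ↥(unitaryGroupOfForm σ J)))) : ↥(unitaryGroupOfForm σ J)) : GL (Fin 3) K) : Matrix (Fin 3) (Fin 3) K) 2 0)) := by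
            field_simp
        _ ≤ (Valued.v θ)⁻¹ * (Valued.v θ * (Valued.v (ϖ ^ i) * Valued.v (ϖ ^ i))) := mul_le_mul_right hle _
        _ = Valued.v (ϖ ^ i) * Valued.v (ϖ ^ i) := by field_simp
  -- the index
  have key := TorusBridge.index_eq_index_units_of_normOne σ ι hι hιv σR hσι hσR hd.vσ hd.v2 hdK hvd hϖR f hf hfs S (2 * i + ε) hS
  change S.index = _
  rw [key]
  rcases Nat.eq_zero_or_pos (2 * i + ε) with h0 | hpos
  · rw [if_pos h0]
    obtain ⟨hi0, hε0⟩ : i = 0 ∧ ε = 0 := by omega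
    subst hi0; subst hε0
    exact Literature.NumberTheory.LocalFields.UnramifiedQuadraticNorm.index_comap_eqLocus_zero σR hσR
  · rw [if_neg (by omega), Literature.NumberTheory.LocalFields.UnramifiedQuadraticNorm.index_comap_eqLocus_eq σR hσR ha hq hpos, mul_comm]

end Weight

end Literature.NumberTheory.Automorphic.UnitaryGroup
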